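import Summits.QuantumFields.BalabanUV.Beta.GAN24.CombContactKernelCells
import Summits.QuantumFields.BalabanUV.Beta.GAN24.CombBornLambdaLineage
import Summits.QuantumFields.BalabanUV.Beta.GAN24.BornLambdaLetters

/-!
# The (III′) Λ-born sector, per lineage: undressed one-shot push plus contact term with the pure-gauge family displayed; the Λ-born row
# of the comb-chart remainder as a three-letter socket, and from per-lineage geometric letters

NOT IN PRINT — OUR BOOKKEEPING (road-P2 = `b2b-balaban-gan24-p2` gen 56, 2026-08-25; row G-an2-4 ∕ (CONV-C), the (α-0) chain at row D1's literal
OF RECORD (III′) `JsB12CombShSym`; [folklore] composition BY NAME; 0 `def`, 0 cite, 0 `def … : Prop`, 0 `sorry`).  Weight 0.  NEVER «G-an2-4 closed» as (CONV-C);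
NOT D1, NOT BetaPertH, NOT continuum, NOT Clay; NO campaign opened (an2 W-4).

This is the (III′) twin of leaf-01 g59's (E) `GAN24/BornLambdaLineage` §4–§5 and `GAN24/BornLambdaLetters` §2–§3 (the Λ-born sector: per-lineage split, the socket,
the geometric summation) over M.58 `CombBornLambdaLineage.unitS_combBornLam_eq_sum_push₃` (the Λ-born remainder in units = fresh source + Σ weighted pushes through the
CONJUGATED chains `T″_i = legChain (j ↦ legComp ψ♭ R_j) i (k−1−i)`, `R_j = respStepBmSeq ρ_c Lc j`, `ρ_c = ctr (d+1) Lc`, `ψ♭ α x κ u = Ψ̂ u x (inl κ) (inl α)`,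
`Ψ̂ = psiKS (ctrOff (d+1) Lc) Lc`) and M.59 `CombContactKernelCells.combLegChain_sub_respStep_of_lt` (each `T″_i − B_i`, `B_i = respStep (Lc^i) (Lc^k)`, is ONE pure-gauge
family — the OWNER gan24-p1 g47's `CombLegChainGauge` decomposition in kernel form), for ANY `tabs : SymTables d Lc` with ff-valued Hessian table (`hHff` displayed):
* §1 **PER LINEAGE: UNDRESSED + CONTACT** — `unitS_combBornLam_eq_undressed_add_contact`:
  `unitS_k (combBornOf Lc tabs cE 0 cΛ k) = X_k + Σ_{i<k} w_i • push₃ B_i B_i B_i X_i + Σ_{i<k} w_i • (push₃ T″_i T″_i T″_i X_i − push₃ B_i B_i B_i X_i)`,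
  `X_i = unitS_i (combFreshAt tabs 0 cΛ i)`, `w_i = (cE·Lc^{2(d+1)})^{k−i}` — leaf-01's (E) display token for token with `freshAt Lc ρ ↦ combFreshAt tabs`, `T_i ↦ T″_i`;
  the UNDRESSED sum is the (E) one read at the sym table (the legs `B_i` carry no `ψ♭`).
* §2 **THE SOCKET** — `exists_hBLam_of_letters` (generic `d`, with `hX`) ∕ `exists_hBLam_of_letters_three` (`d = 3`, `hX` discharged by M.58's `exists_hX_lam_three`): the letter
  `hL` of M.57 `CombBornSectorSplit.exists_hB_of_sectors` (`∃ C δ, 0 < δ ∧ ∀ k, LocStencil (unitS_k (combBornOf Lc tabs cE 0 cΛ k)) C δ`) from three ∕ two letters: the born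
  Λ-pieces' own locality, the weighted UNDRESSED lineages, the weighted CONTACT terms (constants added at the common rate).
* §3 **FROM PER-LINEAGE GEOMETRIC LETTERS** — `exists_hU_of_geometric`, `exists_hC_of_geometric`, `exists_hBLam_of_geometric(_three)`: leaf-01's `BornLambdaLetters.locStencil_sum_of_geometric`
  BY NAME (summands `≤ C·θ^{k−i}`, `0 ≤ θ < 1` ⇒ the sums with the `k`-free constant `C·θ∕(1−θ)`) — the END SHAPE the (III′) Λ half has to deliver, lineage by lineage.
At (III′) there is no in-block-root quantifier: the roots are the centred ones (`ctrOff_mem_box`).  Discharges NO letter; NO estimate; NO value ∕ rate of Bałaban's tables.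
-/

noncomputable section

open Finset
open scoped BigOperators
open Literature.MathematicalPhysics.QuantumFieldTheory
open Literature.MathematicalPhysics.QuantumFieldTheory.Balaban1983to89
open Literature.MathematicalPhysics.QuantumFieldTheory.Balaban1983to89.Beta
open ExpKernelCalculus (MKer)
open AffineAveraging (Site box toSite dz)
open AveragingContoursRooted (ctr ctrOff ctrOff_mem_box)
open KKTFluctuationKernel (delta1)
open OneStepResolventKernel (Fib LocStencil)
open StepJetData (locStencil_add)
open BalabanStepJets (locStencil_mono)
open BalabanCompositeJets (respStep)
open Summit.QuantumFields.BalabanUV.Beta.AxialProjectorBlockMean (bmGaugeAt)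
open Summit.QuantumFields.BalabanUV.Beta.HessKerDressedUnits (unitS)
open Summit.QuantumFields.BalabanUV.Beta.AxialDressingRooted (one_le_of_neZero)
open Summit.QuantumFields.BalabanUV.Beta.SymCorrectorKernel (psiKS)
open Summit.QuantumFields.BalabanUV.Beta.SymmetrisedStepJets (SymTables)
open Summit.QuantumFields.BalabanUV.Beta.GAN24.CombesThomas (sfStep smStep)
open Summit.QuantumFields.BalabanUV.Beta.GAN24.Push4 (legComp IsFF)
open Summit.QuantumFields.BalabanUV.Beta.GAN24.Push4Iter (legChain)
open Summit.QuantumFields.BalabanUV.Beta.GAN24.Push3 (push₃)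
open Summit.QuantumFields.BalabanUV.Beta.GAN24.RespStepBmDecompExact (respStepBmSeq)
open Summit.QuantumFields.BalabanUV.Beta.GAN24.RespStepBmDecompPsi (Psi)
open Summit.QuantumFields.BalabanUV.Beta.GAN24.CombLegChainGauge (PsiFace)
open Summit.QuantumFields.BalabanUV.Beta.GAN24.BornLambdaLetters (locStencil_sum_of_geometric)
open Summit.QuantumFields.BalabanUV.Beta.GAN24.CombWilsonSector (combBornOf)
open Summit.QuantumFields.BalabanUV.Beta.GAN24.CombBornSector (combFreshAt)
open Summit.QuantumFields.BalabanUV.Beta.GAN24.CombBornLambdaLineage (unitS_combBornLam_eq_sum_push₃ exists_hX_lam_three)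
open Summit.QuantumFields.BalabanUV.Beta.GAN24.CombContactKernelCells (combLegChain_sub_respStep_of_lt)

namespace Summit.QuantumFields.BalabanUV.Beta.GAN24.CombBornLambdaSocket

variable {d : ℕ} {Lc : ℕ} [NeZero Lc] (tabs : SymTables d Lc)

/-! ## §1 Per lineage: the undressed one-shot push plus the contact term, with the pure-gauge family displayed -/

omit [NeZero Lc] in
/-- NOT IN PRINT; OUR BOOKKEEPING ([folklore]; M.59 at the centred roots).  **THE LEG DIFFERENCE OF THE (III′) LINEAGE BORN AT LEVEL `i < k` IS ONE PURE-GAUGE FAMILY**: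
`T″_i − B_i = (μ, z, κ, u) ↦ dz (λ″_i μ z) κ u`, `λ″_i μ z = Psi ρ_c Lc i (k−1−i) (delta1 μ z) + PsiFace (ctrOff (d+1) Lc) ρ_c Lc i (k−1−i) (delta1 μ z) − bmGaugeAt ρ_c (B_i μ z) Lc` —
the hypotheses `hL = hR = hW` of leaf-02's `contact_lambda_eq_cells` for this lineage. -/
theorem combLegChain_ctr_sub_respStep_of_lt [NeZero Lc] {i k : ℕ} (hik : i < k) :
    legChain (fun j => legComp (fun α x κ u => psiKS (ctrOff (d + 1) Lc) Lc u x (Sum.inl κ) (Sum.inl α)) (respStepBmSeq (d := d) (ctr (d + 1) Lc) Lc j)) i (k - 1 - i)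
        - respStep (d := d) (Lc ^ i) (Lc ^ k)
      = fun μ z κ u => dz (Psi (ctr (d + 1) Lc) Lc i (k - 1 - i) (delta1 μ z) + PsiFace (ctrOff (d + 1) Lc) (ctr (d + 1) Lc) Lc i (k - 1 - i) (delta1 μ z)
          - bmGaugeAt (ctr (d + 1) Lc) (respStep (d := d) (Lc ^ i) (Lc ^ k) μ z) Lc) κ u :=
  combLegChain_sub_respStep_of_lt (ctrOff_mem_box (one_le_of_neZero Lc)) (ctrOff_mem_box (one_le_of_neZero Lc)) hik

variable (hHff : ∀ μ y, IsFF (tabs.H μ y))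
include hHff

/-- NOT IN PRINT; OUR BOOKKEEPING ((III′) Λ sector, instance side; [folklore]; the twin of leaf-01's `unitS_bornLam_eq_undressed_add_contact`).  **THE (III′) Λ-BORN
REMAINDER IN UNITS = FRESH SOURCE + UNDRESSED LINEAGES + CONTACT TERMS**: with `X_i := unitS_i (combFreshAt tabs 0 cΛ i)`, `w_i := (cE·Lc^{2(d+1)})^{k−i}`,
`T″_i = legChain (j ↦ legComp ψ♭ R_j) i (k−1−i)`, `B_i = respStep (Lc^i) (Lc^k)`,
`unitS_k (combBornOf Lc tabs cE 0 cΛ k) = X_k + Σ_{i<k} w_i • push₃ B_i B_i B_i X_i + Σ_{i<k} w_i • (push₃ T″_i T″_i T″_i X_i − push₃ B_i B_i B_i X_i)`.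
The middle sum is the UNDRESSED Λ row read at the sym Hessian table (no `ψ♭` in it); each summand of the last sum is the contact term of one lineage, whose three leg
differences are the pure-gauge family of `combLegChain_ctr_sub_respStep_of_lt`. -/
theorem unitS_combBornLam_eq_undressed_add_contact (cE cΛ : ℝ) (k : ℕ) :
    unitS (sfStep Lc k) (smStep d Lc k) (combBornOf Lc tabs cE 0 cΛ k)
      = unitS (sfStep Lc k) (smStep d Lc k) (combFreshAt tabs 0 cΛ k)
        + ∑ i ∈ Finset.range k, (fun κ' u' => (cE * (Lc : ℝ) ^ (2 * (d + 1))) ^ (k - i) •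
            push₃ (respStep (d := d) (Lc ^ i) (Lc ^ k)) (respStep (d := d) (Lc ^ i) (Lc ^ k)) (respStep (d := d) (Lc ^ i) (Lc ^ k))
              (unitS (sfStep Lc i) (smStep d Lc i) (combFreshAt tabs 0 cΛ i)) κ' u')
        + ∑ i ∈ Finset.range k, (fun κ' u' => (cE * (Lc : ℝ) ^ (2 * (d + 1))) ^ (k - i) •
            (push₃
                (legChain (fun j => legComp (fun α x κ u => psiKS (ctrOff (d + 1) Lc) Lc u x (Sum.inl κ) (Sum.inl α)) (respStepBmSeq (d := d) (ctr (d + 1) Lc) Lc j)) i (k - 1 - i))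
                (legChain (fun j => legComp (fun α x κ u => psiKS (ctrOff (d + 1) Lc) Lc u x (Sum.inl κ) (Sum.inl α)) (respStepBmSeq (d := d) (ctr (d + 1) Lc) Lc j)) i (k - 1 - i))
                (legChain (fun j => legComp (fun α x κ u => psiKS (ctrOff (d + 1) Lc) Lc u x (Sum.inl κ) (Sum.inl α)) (respStepBmSeq (d := d) (ctr (d + 1) Lc) Lc j)) i (k - 1 - i))
                (unitS (sfStep Lc i) (smStep d Lc i) (combFreshAt tabs 0 cΛ i)) κ' u'
              - push₃ (respStep (d := d) (Lc ^ i) (Lc ^ k)) (respStep (d := d) (Lc ^ i) (Lc ^ k)) (respStep (d := d) (Lc ^ i) (Lc ^ k))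
                (unitS (sfStep Lc i) (smStep d Lc i) (combFreshAt tabs 0 cΛ i)) κ' u')) := by
  rw [unitS_combBornLam_eq_sum_push₃ tabs hHff cE cΛ k, add_assoc, ← Finset.sum_add_distrib]
  congr 1
  refine Finset.sum_congr rfl fun i _ => ?_
  funext κ' u'
  simp only [Pi.add_apply, smul_sub, add_sub_cancel]

/-! ## §2 The (III′) Λ-born row as a three-letter socket -/

/-- NOT IN PRINT; OUR BOOKKEEPING ((III′) socket, Λ sector; the twin of leaf-01's `exists_hBLam_of_letters`).  **THE (III′) Λ-BORN ROW FROM THREE LETTERS**: a `k`-uniform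
`LocStencil` letter for the born Λ-pieces at the sym Hessian table in their own units (`hX` — M.58's (V7)-Λ), one for the UNDRESSED Λ lineages summed over the birth levels with
the weights `(cE·Lc^{2(d+1)})^{k−i}` (`hU`) and one for the CONTACT terms summed the same way (`hC`), give the letter `hL` of M.57's `exists_hB_of_sectors` (constants added
at the common rate; §1's identity). -/
theorem exists_hBLam_of_letters (cE cΛ : ℝ)
    (hX : ∃ C δ : ℝ, 0 < δ ∧ ∀ k : ℕ, LocStencil (unitS (sfStep Lc k) (smStep d Lc k) (combFreshAt tabs 0 cΛ k)) C δ)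
    (hU : ∃ C δ : ℝ, 0 < δ ∧ ∀ k : ℕ,
      LocStencil (∑ i ∈ Finset.range k, fun κ' u' => (cE * (Lc : ℝ) ^ (2 * (d + 1))) ^ (k - i) •
        push₃ (respStep (d := d) (Lc ^ i) (Lc ^ k)) (respStep (d := d) (Lc ^ i) (Lc ^ k)) (respStep (d := d) (Lc ^ i) (Lc ^ k))
          (unitS (sfStep Lc i) (smStep d Lc i) (combFreshAt tabs 0 cΛ i)) κ' u') C δ)
    (hC : ∃ C δ : ℝ, 0 < δ ∧ ∀ k : ℕ,
      LocStencil (∑ i ∈ Finset.range k, fun κ' u' => (cE * (Lc : ℝ) ^ (2 * (d + 1))) ^ (k - i) •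
        (push₃
            (legChain (fun j => legComp (fun α x κ u => psiKS (ctrOff (d + 1) Lc) Lc u x (Sum.inl κ) (Sum.inl α)) (respStepBmSeq (d := d) (ctr (d + 1) Lc) Lc j)) i (k - 1 - i))
            (legChain (fun j => legComp (fun α x κ u => psiKS (ctrOff (d + 1) Lc) Lc u x (Sum.inl κ) (Sum.inl α)) (respStepBmSeq (d := d) (ctr (d + 1) Lc) Lc j)) i (k - 1 - i))
            (legChain (fun j => legComp (fun α x κ u => psiKS (ctrOff (d + 1) Lc) Lc u x (Sum.inl κ) (Sum.inl α)) (respStepBmSeq (d := d) (ctr (d + 1) Lc) Lc j)) i (k - 1 - i))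
            (unitS (sfStep Lc i) (smStep d Lc i) (combFreshAt tabs 0 cΛ i)) κ' u'
          - push₃ (respStep (d := d) (Lc ^ i) (Lc ^ k)) (respStep (d := d) (Lc ^ i) (Lc ^ k)) (respStep (d := d) (Lc ^ i) (Lc ^ k))
            (unitS (sfStep Lc i) (smStep d Lc i) (combFreshAt tabs 0 cΛ i)) κ' u')) C δ) :
    ∃ C δ : ℝ, 0 < δ ∧ ∀ k : ℕ, LocStencil (unitS (sfStep Lc k) (smStep d Lc k) (combBornOf Lc tabs cE 0 cΛ k)) C δ := by
  obtain ⟨CX, δX, hδX, hX⟩ := hX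
  obtain ⟨CU, δU, hδU, hU⟩ := hU
  obtain ⟨CC, δC, hδC, hC⟩ := hC
  refine ⟨CX + CU + CC, min (min δX δU) δC, lt_min (lt_min hδX hδU) hδC, fun k => ?_⟩
  have hCX : 0 ≤ CX := ((hX k) 0 0).nonneg (Sum.inl 0)
  have hCU : 0 ≤ CU := ((hU k) 0 0).nonneg (Sum.inl 0)
  have hCC : 0 ≤ CC := ((hC k) 0 0).nonneg (Sum.inl 0)
  rw [unitS_combBornLam_eq_undressed_add_contact tabs hHff cE cΛ k]
  have h1 := locStencil_mono (hX k) hCX (show min (min δX δU) δC ≤ δX from (min_le_left _ _).trans (min_le_left _ _))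
  have h2 := locStencil_mono (hU k) hCU (show min (min δX δU) δC ≤ δU from (min_le_left _ _).trans (min_le_right _ _))
  have h3 := locStencil_mono (hC k) hCC (show min (min δX δU) δC ≤ δC from min_le_right _ _)
  exact locStencil_add (locStencil_add h1 h2) h3

omit hHff in
/-- NOT IN PRINT; OUR BOOKKEEPING ((III′) socket, Λ sector, `d = 3`: the first letter DISCHARGED by M.58's `exists_hX_lam_three` — road P1's `FibreStrip.unitDecayK_holds`).
**THE (III′) Λ-BORN ROW OF THE `d = 3` FAMILY FROM TWO LETTERS** — the weighted UNDRESSED lineages (`hU`) and the weighted CONTACT terms (`hC`). -/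
theorem exists_hBLam_of_letters_three {Lc : ℕ} [NeZero Lc] (tabs : SymTables 3 Lc) (hHff : ∀ μ y, IsFF (tabs.H μ y)) (cE cΛ : ℝ)
    (hU : ∃ C δ : ℝ, 0 < δ ∧ ∀ k : ℕ,
      LocStencil (∑ i ∈ Finset.range k, fun κ' u' => (cE * (Lc : ℝ) ^ (2 * (3 + 1))) ^ (k - i) •
        push₃ (respStep (d := 3) (Lc ^ i) (Lc ^ k)) (respStep (d := 3) (Lc ^ i) (Lc ^ k)) (respStep (d := 3) (Lc ^ i) (Lc ^ k))
          (unitS (sfStep Lc i) (smStep 3 Lc i) (combFreshAt tabs 0 cΛ i)) κ' u') C δ)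
    (hC : ∃ C δ : ℝ, 0 < δ ∧ ∀ k : ℕ,
      LocStencil (∑ i ∈ Finset.range k, fun κ' u' => (cE * (Lc : ℝ) ^ (2 * (3 + 1))) ^ (k - i) •
        (push₃
            (legChain (fun j => legComp (fun α x κ u => psiKS (ctrOff (3 + 1) Lc) Lc u x (Sum.inl κ) (Sum.inl α)) (respStepBmSeq (d := 3) (ctr (3 + 1) Lc) Lc j)) i (k - 1 - i))
            (legChain (fun j => legComp (fun α x κ u => psiKS (ctrOff (3 + 1) Lc) Lc u x (Sum.inl κ) (Sum.inl α)) (respStepBmSeq (d := 3) (ctr (3 + 1) Lc) Lc j)) i (k - 1 - i))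
            (legChain (fun j => legComp (fun α x κ u => psiKS (ctrOff (3 + 1) Lc) Lc u x (Sum.inl κ) (Sum.inl α)) (respStepBmSeq (d := 3) (ctr (3 + 1) Lc) Lc j)) i (k - 1 - i))
            (unitS (sfStep Lc i) (smStep 3 Lc i) (combFreshAt tabs 0 cΛ i)) κ' u'
          - push₃ (respStep (d := 3) (Lc ^ i) (Lc ^ k)) (respStep (d := 3) (Lc ^ i) (Lc ^ k)) (respStep (d := 3) (Lc ^ i) (Lc ^ k))
            (unitS (sfStep Lc i) (smStep 3 Lc i) (combFreshAt tabs 0 cΛ i)) κ' u')) C δ) :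
    ∃ C δ : ℝ, 0 < δ ∧ ∀ k : ℕ, LocStencil (unitS (sfStep Lc k) (smStep 3 Lc k) (combBornOf Lc tabs cE 0 cΛ k)) C δ :=
  exists_hBLam_of_letters (d := 3) tabs hHff cE cΛ (exists_hX_lam_three tabs hHff cΛ) hU hC

/-! ## §3 The (III′) Λ-born row from per-lineage geometric letters -/

omit hHff in
omit [NeZero Lc] in
/-- NOT IN PRINT; OUR BOOKKEEPING (the twin of leaf-01's `BornLambdaLetters.exists_hU_of_geometric`).  **THE UNDRESSED-LINEAGE LETTER `hU` FROM A PER-LINEAGE GEOMETRIC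
LETTER**: if every weighted undressed Λ lineage `w_i • push₃ B_i B_i B_i X_i`, `i < k`, is a local stencil family with constant `C·θ^{k−i}` at one rate (`0 ≤ C`, `0 ≤ θ < 1`),
their sum over `i < k` is one with the `k`-free constant `C·θ∕(1−θ)` (`locStencil_sum_of_geometric` BY NAME). -/
theorem exists_hU_of_geometric [NeZero Lc] (cE cΛ : ℝ)
    (hUg : ∃ C θ δ : ℝ, 0 ≤ C ∧ 0 ≤ θ ∧ θ < 1 ∧ 0 < δ ∧ ∀ k i : ℕ, i < k →
      LocStencil (fun κ' u' => (cE * (Lc : ℝ) ^ (2 * (d + 1))) ^ (k - i) •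
        push₃ (respStep (d := d) (Lc ^ i) (Lc ^ k)) (respStep (d := d) (Lc ^ i) (Lc ^ k)) (respStep (d := d) (Lc ^ i) (Lc ^ k))
          (unitS (sfStep Lc i) (smStep d Lc i) (combFreshAt tabs 0 cΛ i)) κ' u') (C * θ ^ (k - i)) δ) :
    ∃ C δ : ℝ, 0 < δ ∧ ∀ k : ℕ,
      LocStencil (∑ i ∈ Finset.range k, fun κ' u' => (cE * (Lc : ℝ) ^ (2 * (d + 1))) ^ (k - i) •
        push₃ (respStep (d := d) (Lc ^ i) (Lc ^ k)) (respStep (d := d) (Lc ^ i) (Lc ^ k)) (respStep (d := d) (Lc ^ i) (Lc ^ k))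
          (unitS (sfStep Lc i) (smStep d Lc i) (combFreshAt tabs 0 cΛ i)) κ' u') C δ := by
  obtain ⟨C, θ, δ, hC, hθ0, hθ1, hδ, h⟩ := hUg
  exact ⟨C * (θ / (1 - θ)), δ, hδ, fun k => locStencil_sum_of_geometric hC hθ0 hθ1 k fun i hi => h k i hi⟩

omit hHff in
omit [NeZero Lc] in
/-- NOT IN PRINT; OUR BOOKKEEPING (the twin of leaf-01's `BornLambdaLetters.exists_hC_of_geometric`).  **THE CONTACT LETTER `hC` FROM A PER-LINEAGE GEOMETRIC LETTER**:
per-lineage constants `C·θ^{k−i}` for the weighted (III′) contact terms ⇒ the sum with `C·θ∕(1−θ)`. -/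
theorem exists_hC_of_geometric [NeZero Lc] (cE cΛ : ℝ)
    (hCg : ∃ C θ δ : ℝ, 0 ≤ C ∧ 0 ≤ θ ∧ θ < 1 ∧ 0 < δ ∧ ∀ k i : ℕ, i < k →
      LocStencil (fun κ' u' => (cE * (Lc : ℝ) ^ (2 * (d + 1))) ^ (k - i) •
        (push₃
            (legChain (fun j => legComp (fun α x κ u => psiKS (ctrOff (d + 1) Lc) Lc u x (Sum.inl κ) (Sum.inl α)) (respStepBmSeq (d := d) (ctr (d + 1) Lc) Lc j)) i (k - 1 - i))
            (legChain (fun j => legComp (fun α x κ u => psiKS (ctrOff (d + 1) Lc) Lc u x (Sum.inl κ) (Sum.inl α)) (respStepBmSeq (d := d) (ctr (d + 1) Lc) Lc j)) i (k - 1 - i))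
            (legChain (fun j => legComp (fun α x κ u => psiKS (ctrOff (d + 1) Lc) Lc u x (Sum.inl κ) (Sum.inl α)) (respStepBmSeq (d := d) (ctr (d + 1) Lc) Lc j)) i (k - 1 - i))
            (unitS (sfStep Lc i) (smStep d Lc i) (combFreshAt tabs 0 cΛ i)) κ' u'
          - push₃ (respStep (d := d) (Lc ^ i) (Lc ^ k)) (respStep (d := d) (Lc ^ i) (Lc ^ k)) (respStep (d := d) (Lc ^ i) (Lc ^ k))
            (unitS (sfStep Lc i) (smStep d Lc i) (combFreshAt tabs 0 cΛ i)) κ' u')) (C * θ ^ (k - i)) δ) :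
    ∃ C δ : ℝ, 0 < δ ∧ ∀ k : ℕ,
      LocStencil (∑ i ∈ Finset.range k, fun κ' u' => (cE * (Lc : ℝ) ^ (2 * (d + 1))) ^ (k - i) •
        (push₃
            (legChain (fun j => legComp (fun α x κ u => psiKS (ctrOff (d + 1) Lc) Lc u x (Sum.inl κ) (Sum.inl α)) (respStepBmSeq (d := d) (ctr (d + 1) Lc) Lc j)) i (k - 1 - i))
            (legChain (fun j => legComp (fun α x κ u => psiKS (ctrOff (d + 1) Lc) Lc u x (Sum.inl κ) (Sum.inl α)) (respStepBmSeq (d := d) (ctr (d + 1) Lc) Lc j)) i (k - 1 - i))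
            (legChain (fun j => legComp (fun α x κ u => psiKS (ctrOff (d + 1) Lc) Lc u x (Sum.inl κ) (Sum.inl α)) (respStepBmSeq (d := d) (ctr (d + 1) Lc) Lc j)) i (k - 1 - i))
            (unitS (sfStep Lc i) (smStep d Lc i) (combFreshAt tabs 0 cΛ i)) κ' u'
          - push₃ (respStep (d := d) (Lc ^ i) (Lc ^ k)) (respStep (d := d) (Lc ^ i) (Lc ^ k)) (respStep (d := d) (Lc ^ i) (Lc ^ k))
            (unitS (sfStep Lc i) (smStep d Lc i) (combFreshAt tabs 0 cΛ i)) κ' u')) C δ := by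
  obtain ⟨C, θ, δ, hC, hθ0, hθ1, hδ, h⟩ := hCg
  exact ⟨C * (θ / (1 - θ)), δ, hδ, fun k => locStencil_sum_of_geometric hC hθ0 hθ1 k fun i hi => h k i hi⟩

/-- NOT IN PRINT; OUR BOOKKEEPING ((III′) Λ half, END SHAPE; generic `d`; the twin of leaf-01's `exists_hBLam_of_geometric`).  **THE (III′) Λ-BORN ROW FROM PER-LINEAGE
GEOMETRIC LETTERS**: the born Λ-pieces' own locality `hX`, a geometric letter for every weighted UNDRESSED lineage and one for every weighted CONTACT term (constants `C·θ^{k−i}`,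
`θ < 1`, one rate) give the letter `hL` of M.57's `exists_hB_of_sectors`. -/
theorem exists_hBLam_of_geometric (cE cΛ : ℝ)
    (hX : ∃ C δ : ℝ, 0 < δ ∧ ∀ k : ℕ, LocStencil (unitS (sfStep Lc k) (smStep d Lc k) (combFreshAt tabs 0 cΛ k)) C δ)
    (hUg : ∃ C θ δ : ℝ, 0 ≤ C ∧ 0 ≤ θ ∧ θ < 1 ∧ 0 < δ ∧ ∀ k i : ℕ, i < k →
      LocStencil (fun κ' u' => (cE * (Lc : ℝ) ^ (2 * (d + 1))) ^ (k - i) •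
        push₃ (respStep (d := d) (Lc ^ i) (Lc ^ k)) (respStep (d := d) (Lc ^ i) (Lc ^ k)) (respStep (d := d) (Lc ^ i) (Lc ^ k))
          (unitS (sfStep Lc i) (smStep d Lc i) (combFreshAt tabs 0 cΛ i)) κ' u') (C * θ ^ (k - i)) δ)
    (hCg : ∃ C θ δ : ℝ, 0 ≤ C ∧ 0 ≤ θ ∧ θ < 1 ∧ 0 < δ ∧ ∀ k i : ℕ, i < k →
      LocStencil (fun κ' u' => (cE * (Lc : ℝ) ^ (2 * (d + 1))) ^ (k - i) •
        (push₃
            (legChain (fun j => legComp (fun α x κ u => psiKS (ctrOff (d + 1) Lc) Lc u x (Sum.inl κ) (Sum.inl α)) (respStepBmSeq (d := d) (ctr (d + 1) Lc) Lc j)) i (k - 1 - i))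
            (legChain (fun j => legComp (fun α x κ u => psiKS (ctrOff (d + 1) Lc) Lc u x (Sum.inl κ) (Sum.inl α)) (respStepBmSeq (d := d) (ctr (d + 1) Lc) Lc j)) i (k - 1 - i))
            (legChain (fun j => legComp (fun α x κ u => psiKS (ctrOff (d + 1) Lc) Lc u x (Sum.inl κ) (Sum.inl α)) (respStepBmSeq (d := d) (ctr (d + 1) Lc) Lc j)) i (k - 1 - i))
            (unitS (sfStep Lc i) (smStep d Lc i) (combFreshAt tabs 0 cΛ i)) κ' u'
          - push₃ (respStep (d := d) (Lc ^ i) (Lc ^ k)) (respStep (d := d) (Lc ^ i) (Lc ^ k)) (respStep (d := d) (Lc ^ i) (Lc ^ k))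
            (unitS (sfStep Lc i) (smStep d Lc i) (combFreshAt tabs 0 cΛ i)) κ' u')) (C * θ ^ (k - i)) δ) :
    ∃ C δ : ℝ, 0 < δ ∧ ∀ k : ℕ, LocStencil (unitS (sfStep Lc k) (smStep d Lc k) (combBornOf Lc tabs cE 0 cΛ k)) C δ :=
  exists_hBLam_of_letters tabs hHff cE cΛ hX (exists_hU_of_geometric tabs cE cΛ hUg) (exists_hC_of_geometric tabs cE cΛ hCg)

omit hHff in
/-- NOT IN PRINT; OUR BOOKKEEPING ((III′) Λ half, END SHAPE at `d = 3`; the twin of leaf-01's `exists_hBLam_of_geometric_three`).  **THE (III′) Λ-BORN ROW OF THE `d = 3`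
FAMILY FROM TWO PER-LINEAGE GEOMETRIC LETTERS** — the undressed lineages read at the sym Hessian table and the contact terms through the conjugated chains, each `≤ C·θ^{k−i}` in
`LocStencil` form; `hX` is M.58's `exists_hX_lam_three`.  This is the statement the (III′) Λ half has to prove, lineage by lineage; nothing of it is claimed here. -/
theorem exists_hBLam_of_geometric_three {Lc : ℕ} [NeZero Lc] (tabs : SymTables 3 Lc) (hHff : ∀ μ y, IsFF (tabs.H μ y)) (cE cΛ : ℝ)
    (hUg : ∃ C θ δ : ℝ, 0 ≤ C ∧ 0 ≤ θ ∧ θ < 1 ∧ 0 < δ ∧ ∀ k i : ℕ, i < k →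
      LocStencil (fun κ' u' => (cE * (Lc : ℝ) ^ (2 * (3 + 1))) ^ (k - i) •
        push₃ (respStep (d := 3) (Lc ^ i) (Lc ^ k)) (respStep (d := 3) (Lc ^ i) (Lc ^ k)) (respStep (d := 3) (Lc ^ i) (Lc ^ k))
          (unitS (sfStep Lc i) (smStep 3 Lc i) (combFreshAt tabs 0 cΛ i)) κ' u') (C * θ ^ (k - i)) δ)
    (hCg : ∃ C θ δ : ℝ, 0 ≤ C ∧ 0 ≤ θ ∧ θ < 1 ∧ 0 < δ ∧ ∀ k i : ℕ, i < k →
      LocStencil (fun κ' u' => (cE * (Lc : ℝ) ^ (2 * (3 + 1))) ^ (k - i) •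
        (push₃
            (legChain (fun j => legComp (fun α x κ u => psiKS (ctrOff (3 + 1) Lc) Lc u x (Sum.inl κ) (Sum.inl α)) (respStepBmSeq (d := 3) (ctr (3 + 1) Lc) Lc j)) i (k - 1 - i))
            (legChain (fun j => legComp (fun α x κ u => psiKS (ctrOff (3 + 1) Lc) Lc u x (Sum.inl κ) (Sum.inl α)) (respStepBmSeq (d := 3) (ctr (3 + 1) Lc) Lc j)) i (k - 1 - i))
            (legChain (fun j => legComp (fun α x κ u => psiKS (ctrOff (3 + 1) Lc) Lc u x (Sum.inl κ) (Sum.inl α)) (respStepBmSeq (d := 3) (ctr (3 + 1) Lc) Lc j)) i (k - 1 - i))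
            (unitS (sfStep Lc i) (smStep 3 Lc i) (combFreshAt tabs 0 cΛ i)) κ' u'
          - push₃ (respStep (d := 3) (Lc ^ i) (Lc ^ k)) (respStep (d := 3) (Lc ^ i) (Lc ^ k)) (respStep (d := 3) (Lc ^ i) (Lc ^ k))
            (unitS (sfStep Lc i) (smStep 3 Lc i) (combFreshAt tabs 0 cΛ i)) κ' u')) (C * θ ^ (k - i)) δ) :
    ∃ C δ : ℝ, 0 < δ ∧ ∀ k : ℕ, LocStencil (unitS (sfStep Lc k) (smStep 3 Lc k) (combBornOf Lc tabs cE 0 cΛ k)) C δ :=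
  exists_hBLam_of_geometric (d := 3) tabs hHff cE cΛ (exists_hX_lam_three tabs hHff cΛ) hUg hCg

end Summit.QuantumFields.BalabanUV.Beta.GAN24.CombBornLambdaSocket

end
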